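/-
REFILED by p1 gen 67 (prover-pub-hodgecm2-p1-g67-0) for tr-prover-3 (writer of record, silent since 14:59Z; lead word HOME/INBOX l.4422/l.4557 (A), acting tr-prover-3) after p283774 BOUNCED 18:1xZ at the gateʼs post-hostage retry (elab: `UnitaryGroup.cmAdelicProdEquiv`/`cmSplitLevel`/`cmSplitProj`/`mem_splitLevel_iff` and `Kaehler.holFormsInCharts` unknown — two imports that only the concat probes supplied). DELTA vs tr-prover-3ʼs ebf7d0fb418b: + `import Literature.NumberTheory.Automorphic.UnitaryGroupArchLatticeJunction`, − the unused `open Literature.Geometry.Kaehler (holFormsInCharts)`; every declaration byte-identical. T5: n/a (0 hypothesis binders; t5-consist-1 l.4579). HC_CM is NOT proved.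
COR-CM cell pub-hodgecm2 — TRANSPOSITION surge, dictionary item (iii) (rfwf v3 §4.2 (iii), tex ll.245–246), file D3a of the split of
HOME/INBOX l.3828/l.3842 (tr-prover-3 ↔ p1): the MEETING LEVEL of two levels at a rational isometry and the adelic bookkeeping
of split levels used by the level-meeting field of the automorphic dictionary (`Item3LevelMeetHolds.lean`).  Seat
prover-pub-hodgecm2-tr-prover-3-0, 2026-08-21.  One `Level` constructor, two abbreviations, theorems; nothing asserted.
FRAMING: HC_CM is NOT proved.
-/
import Summits.HodgeConjecture.CorCM.B01.HeckePair
import Literature.NumberTheory.Automorphic.LevelOrbitTwoPieceMeeting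
import Literature.NumberTheory.Automorphic.UnitaryGroupArchLatticeJunction
import HarnessLib

/-!
# Transposition item (iii), D3a: the meeting level `(Γ₁ ∩ γ⁻¹Γ₂γ, K₁ ∩ γ_f⁻¹K₂γ_f)` and split-level bookkeeping

* `Level.meetConj Γ₁ Γ₂ γ hγ` — the two-level form of `Level.heckePair` (`B01/HeckePair.lean`): the pair
  `(Γ₁ ∩ γ⁻¹Γ₂γ, K₁ ∩ γ_f⁻¹K₂γ_f)` for a rational isometry `γ ∈ U(V)(L)`; it carries the level covering to `P_{Γ₁}`
  (`Γ' ≤ Γ₁`, `meetConj_Γ_le_left`) and the Hecke translation `[v] ↦ [γ v]` to `P_{Γ₂}` (`γ Γ' γ⁻¹ ≤ Γ₂`, `map_conj_meetConj_Γ_le`).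
* `Model.archP V` / `Model.finP V` — the two components of `U(V)(𝔸_{L⁺}) ≃ U(V)(L ⊗ ℝ) × U(V)(𝔸_{L⁺,f})`
  (`UnitaryGroup.cmAdelicProdEquiv`); `Model.conjLevel_inf_cmSplitLevel_eq` — for `k ∈ M_{K₁}`,
  `k⁻¹(M_{K₁} ∩ M_{K₂})k = M_{K₁ ∩ k_f⁻¹K₂k_f}` (the level produced by the two-piece meeting lemma
  `LevelOrbit.exists_mem_inner_pieceLiftLp_rightCast_ne_zero` IS a split level).
-/

noncomputable section

set_option autoImplicit false

open scoped Matrix ComplexOrder TensorProduct InnerProductSpace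
open NumberField MeasureTheory CategoryTheory
open Literature.AlgebraicGeometry.Motives
open Literature.AlgebraicGeometry.ShimuraVarieties
open Literature.AlgebraicGeometry.HodgeTheory
open Literature.Geometry.ComplexHyperbolic.BallModel (U21 Ball x₀)
open Literature.NumberTheory.Automorphic
open Literature.NumberTheory.Automorphic.PicardCM
open Literature.NumberTheory.Automorphic.LevelOrbit

namespace Summit.HodgeConjecture.CorCM

/-! ### 1. The meeting level `(Γ₁ ∩ γ⁻¹Γ₂γ, K₁ ∩ γ_f⁻¹K₂γ_f)` of two levels and a rational isometry -/

namespace Level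

variable {L : CMField} {ι₁ : L →+* ℂ} {V : HermSpace3 L ι₁}

/-- **The meeting level of `Γ₁`, `Γ₂` at the rational isometry `γ ∈ U(V)(L)`**: the pair
`(Γ₁ ∩ γ⁻¹Γ₂γ, K₁ ∩ γ_f⁻¹K₂γ_f)` (compact open; arithmetic level by `UnitaryGroup.arithmeticLevel_map_conj`, Platonov–Rapinchuk
§4.1; torsion-free inside `Γ₁`) — the two-level form of `Level.heckePair` (`B01/HeckePair.lean`).  It carries the level
covering to `P_{Γ₁}` and the Hecke translation `[v] ↦ [γ v]` to `P_{Γ₂}`. [cite: Shimura1973, §3.1 Prop. 3.1] -/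
def meetConj (Γ₁ Γ₂ : Level V) (γ : GL (Fin 3) L) (hγ : γ ∈ unitaryGroup (cmConjRingHom L) V.Hm) : Level V where
  Γ := Γ₁.Γ ⊓ Γ₂.Γ.map (MulAut.conj γ⁻¹).toMonoidHom
  K := Γ₁.K ⊓ Γ₂.K.map (MulAut.conj (UnitaryGroup.rationalToFinAdelic (↥(maximalRealSubfield L)) L
    (IsCMField.complexConj L) 3 V.Hm (rationalOf V γ hγ)⁻¹)).toMonoidHom
  isCompact_K := Subgroup.isCompact_inf_of_isOpen Γ₁.isCompact_K Γ₁.isOpen_K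
    (Subgroup.isOpen_map_conj Γ₂.isOpen_K _)
  isOpen_K := by
    rw [Subgroup.coe_inf]
    exact Γ₁.isOpen_K.inter (Subgroup.isOpen_map_conj Γ₂.isOpen_K _)
  arithmeticLevel_K := by
    rw [UnitaryGroup.arithmeticLevel_inf, UnitaryGroup.arithmeticLevel_map_conj, Γ₁.arithmeticLevel_K,
      Γ₂.arithmeticLevel_K]
    rfl
  torsionFree δ hδ hfin := Γ₁.torsionFree δ (Subgroup.mem_inf.mp hδ).1 hfin

/-- The arithmetic group of the meeting level is `Γ₁ ∩ γ⁻¹Γ₂γ`. [folklore] -/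
@[simp] theorem meetConj_Γ (Γ₁ Γ₂ : Level V) {γ : GL (Fin 3) L} (hγ : γ ∈ unitaryGroup (cmConjRingHom L) V.Hm) : (Γ₁.meetConj Γ₂ γ hγ).Γ = Γ₁.Γ ⊓ Γ₂.Γ.map (MulAut.conj γ⁻¹).toMonoidHom := rfl

/-- The compact open of the meeting level is `K₁ ∩ γ_f⁻¹K₂γ_f`. [folklore] -/
theorem meetConj_K (Γ₁ Γ₂ : Level V) {γ : GL (Fin 3) L} (hγ : γ ∈ unitaryGroup (cmConjRingHom L) V.Hm) : (Γ₁.meetConj Γ₂ γ hγ).K = Γ₁.K ⊓ Γ₂.K.map (MulAut.conj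
    (UnitaryGroup.rationalToFinAdelic (↥(maximalRealSubfield L)) L (IsCMField.complexConj L) 3 V.Hm
      (rationalOf V γ hγ)⁻¹)).toMonoidHom := rfl

/-- `Γ₁ ∩ γ⁻¹Γ₂γ ≤ Γ₁`. [folklore] -/
theorem meetConj_Γ_le_left (Γ₁ Γ₂ : Level V) {γ : GL (Fin 3) L} (hγ : γ ∈ unitaryGroup (cmConjRingHom L) V.Hm) : (Γ₁.meetConj Γ₂ γ hγ).Γ ≤ Γ₁.Γ := inf_le_left

/-- **`γ (Γ₁ ∩ γ⁻¹Γ₂γ) γ⁻¹ ≤ Γ₂`** — the hypothesis of the Hecke translation `[v] ↦ [γ v] : P_{Γ'} → P_{Γ₂}`.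
[cite: Shimura1973, §7.2–7.3] -/
theorem map_conj_meetConj_Γ_le (Γ₁ Γ₂ : Level V) {γ : GL (Fin 3) L} (hγ : γ ∈ unitaryGroup (cmConjRingHom L) V.Hm) : (Γ₁.meetConj Γ₂ γ hγ).Γ.map (MulAut.conj γ).toMonoidHom ≤ Γ₂.Γ := by
  rintro _ ⟨δ, hδ, rfl⟩
  have h := (Subgroup.mem_map_conj_iff _ _ _).1 (Subgroup.mem_inf.mp hδ).2
  simpa [MulAut.conj_apply] using h

end Level

/-! ### 2. Adelic bookkeeping on `U(V)(𝔸) ⧸ U(V)(L⁺)` -/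

namespace Model

section Adelic

variable {L : CMField} {ι₁ : L →+* ℂ} (V : HermSpace3 L ι₁)

/-- The archimedean component `U(V)(𝔸_{L⁺}) →* U(V)(L ⊗ ℝ)` (first factor of `cmAdelicProdEquiv`). [folklore] -/
abbrev archP : ↥(adelicUnitaryGroup L V.Hm) →* UnitaryGroup.arch (↥(maximalRealSubfield L)) L (IsCMField.complexConj L) 3 V.Hm :=
  (MonoidHom.fst _ _).comp (UnitaryGroup.cmAdelicProdEquiv (L : Type) 3 V.Hm).toMulEquiv.toMonoidHom

/-- The finite-adelic component `U(V)(𝔸_{L⁺}) →* U(V)(𝔸_{L⁺,f})` (second factor of `cmAdelicProdEquiv`). [folklore] -/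
abbrev finP : ↥(adelicUnitaryGroup L V.Hm) →* V.adelicFin :=
  (MonoidHom.snd _ _).comp (UnitaryGroup.cmAdelicProdEquiv (L : Type) 3 V.Hm).toMulEquiv.toMonoidHom

/-- `archP` is continuous. [folklore] -/
theorem continuous_archP : Continuous (archP V) :=
  continuous_fst.comp (UnitaryGroup.cmAdelicProdEquiv (L : Type) 3 V.Hm).continuous

/-- The split projection of a level is the restriction of `archP` (definitional). [folklore] -/
theorem cmSplitProj_eq_archP (K : Subgroup V.adelicFin) (m : UnitaryGroup.cmSplitLevel (L : Type) 3 V.Hm K) :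
    UnitaryGroup.cmSplitProj (L : Type) 3 V.Hm K m = archP V m := rfl

/-- **Conjugating the meet of two split levels by an element of the first**: for `k ∈ M_{K₁}`,
`k⁻¹ (M_{K₁} ∩ M_{K₂}) k = M_{K₁ ∩ k_f⁻¹ K₂ k_f}` (the archimedean factor is the whole group on both sides). [folklore] -/
theorem conjLevel_inf_cmSplitLevel_eq (K₁ K₂ : Subgroup V.adelicFin)
    (k : UnitaryGroup.cmSplitLevel (L : Type) 3 V.Hm K₁) :
    conjLevel (UnitaryGroup.cmSplitLevel (L : Type) 3 V.Hm K₁ ⊓ UnitaryGroup.cmSplitLevel (L : Type) 3 V.Hm K₂)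
        ((k : ↥(adelicUnitaryGroup L V.Hm)))⁻¹ =
      UnitaryGroup.cmSplitLevel (L : Type) 3 V.Hm (K₁ ⊓ K₂.map (MulAut.conj (finP V k)⁻¹).toMonoidHom) := by
  have hk : finP V k ∈ K₁ := (mem_splitLevel_iff _ K₁ _).mp k.2
  ext g
  rw [mem_conjLevel_iff, inv_inv, Subgroup.mem_inf, mem_splitLevel_iff, mem_splitLevel_iff, mem_splitLevel_iff,
    Subgroup.mem_inf, Subgroup.mem_map_conj_iff]
  change finP V ((k : ↥(adelicUnitaryGroup L V.Hm)) * g * ((k : ↥(adelicUnitaryGroup L V.Hm)))⁻¹) ∈ K₁ ∧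
      finP V ((k : ↥(adelicUnitaryGroup L V.Hm)) * g * ((k : ↥(adelicUnitaryGroup L V.Hm)))⁻¹) ∈ K₂ ↔
    finP V g ∈ K₁ ∧ ((finP V k)⁻¹)⁻¹ * finP V g * (finP V k)⁻¹ ∈ K₂
  rw [map_mul, map_mul, map_inv, inv_inv]
  constructor
  · rintro ⟨h1, h2⟩
    refine ⟨?_, ?_⟩
    · have := K₁.mul_mem (K₁.mul_mem (K₁.inv_mem hk) h1) hk
      simpa [mul_assoc] using this
    · simpa [mul_assoc, MulAut.conj_apply] using h2
  · rintro ⟨h1, h2⟩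
    refine ⟨K₁.mul_mem (K₁.mul_mem hk h1) (K₁.inv_mem hk), ?_⟩
    simpa [mul_assoc, MulAut.conj_apply] using h2

end Adelic

end Model

end Summit.HodgeConjecture.CorCM

end
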